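import Summits.HodgeConjecture.CorCM.Census.NondegenerateSplitting
import Summits.HodgeConjecture.CorCM.Census.TwoAdicSplittingRelative

/-!
# Nondegenerate splitting RELATIVE to a `2`-subgroup: the META theorem `μ(G,c) = φ₂(G,c)` without `IsPGroup`

COR-CM (cell `pub-hodgecm2`), count-neutral kernel combinatorics by the binder seat b09 (gen 40; lane RELATIVE SPLITTING, part II), the assembly of
part A `Census/NondegenerateReduction.lean` (gen 38, ANY `(G,c)`: `two_pow_smul_mem_psp_of_reduction`, `reduction_of_residual`), part C
`Census/BaseBlockCovering.lean` (gen 38, ANY `(G,c)`) and the relative splitting `Census/TwoAdicSplittingRelative.lean` (gen 40), all BY NAME.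
Theorems only: no definition, no `decide`, no certificate, no named fact, no `sorry`.
HONEST FRAMING: `HC_CM` is NOT proved, here or anywhere in the tree; nothing here is a period or a headline.

**THE RELATIVE META-THEOREM (`isLeast_card_gfaces_generate_of_reduction_rel`).**  Let `G` be a finite group FACTORISED as `G = ι(Γ)·⟨N⟩` with
`Γ` a `2`-group (`ι : Γ → G` a homomorphism, `N ⊆ G` any set of elements; e.g. a Sylow `2`-subgroup and generators of a `2`-complement —
normality is not used), `c` a central involution `≠ 1`, `T₀` a NONDEGENERATE CM type (Kubota: the antisymmetric convolution with `1_{T₀}` is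
injective), and `S ⊆ gfaceSet` a finite FIBRE-INDEPENDENT family of faces such that
* (reduction) every CM type reduces modulo `ℤ⟨pairs⟩ + ℤ⟨base changes of S⟩` to an integer combination of the base changes of `T₀`, up to `2^k`;
* (`N`-coboundaries) for every face `f` and every `n ∈ N`, `f·n⁻¹ − f ∈ ℤ⟨pairs⟩ + ℤ⟨base changes of S⟩` MOD `2`.
Then the least number of face relations whose base changes generate the Hodge lattice modulo pairs is EXACTLY `φ₂(G,c)`, attained by a family
containing `S`: **`μ(G,c) = φ₂(G,c)`**.  For a `2`-group take `Γ = G`, `N = ∅`: gen 38ʼs `isLeast_card_gfaces_generate_of_reduction`.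
The residual form (`…_of_residual_reduction_rel`) asks the reduction only for the RESIDUAL types of `T₀` (potential `≤ 1`) once `S` contains a
covering family (`Splitting.exists_cover_sub`, any `(G,c)`).

WHY (the successor lanes this serves).  The quaternion column `Q_{4n}` is closed for `n = 2^m` only (`Census/QuaternionColumnPivot.lean`); for
general even `n = 2^a·m` the group `Q_{4n} = ⟨a^{2^{a+1}}⟩ ⋊ Q_{2^{a+2}}` is factorised with `N = {a^{2^{a+1}}}`, and gen 39ʼs biarc circle and
chains give the reduction with `k = 1`; what remains there is ONE coboundary statement: `f·a^{−2^{a+1}} − f ∈ ℤ⟨pairs⟩ + ℤ[G]·qfam` mod `2` for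
the faces `f`.  The same shape serves the metacyclic column `ℤ/m ⋊ ℤ/2^k` (`k ≥ 3`), the products `P × B` (`B` of odd order) and `SL₂(𝔽₃) =
Q₈·⟨3-cycle⟩`.

## References
* [Pohlmann1968] H. Pohlmann, Algebraic cycles on abelian varieties of complex multiplication type, Ann. of Math. 88 (1968), Thm 1.
* [Milne1999] J. S. Milne, Lefschetz motives and the Tate conjecture, Compositio Math. 117 (1999), Prop. 2.1, p. 54.
-/

namespace Summit.HodgeConjecture.CorCM.Census.Splitting

open Finset
open Summit.HodgeConjecture.CorCM.Prior.AllgGroup.RfwfAllgGroup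
open Summit.HodgeConjecture.CorCM.Census.BlockParity
open Summit.HodgeConjecture.CorCM.Census.Coinvariant
open Summit.HodgeConjecture.CorCM.Census.Nondegenerate
open Summit.HodgeConjecture.CorCM.Census.BaseBlock

noncomputable section

variable {G : Type*} [Group G] [Fintype G] [DecidableEq G] (c : G)
variable {Γ : Type*} [Group Γ]

/-- **RELATIVE META-THEOREM, existence form.**  Factorised `G = ι(Γ)·⟨N⟩`, nondegenerate base type `T₀`, fibre-independent faces `S` reducing every
type onto the base changes of `T₀` up to `2^k` and whose target contains the `N`-coboundaries of the faces mod `2` `⟹` `S` extends to EXACTLY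
`φ₂(G,c)` faces generating the Hodge lattice modulo pairs. [folklore] -/
theorem exists_generate_of_reduction_rel (hΓ : IsPGroup 2 Γ) (ι : Γ →* G) (N : Set G)
    (hcov : ∀ Q : G, ∃ γ : Γ, ∃ n ∈ Subgroup.closure N, Q = ι γ * n)
    (hc2 : c * c = 1) (hc1 : c ≠ 1) (hcen : ∀ x : G, x * c = c * x) (T₀ : CMF G c)
    (hT₀ : ∀ f : G → ℤ, (∀ Q, f (c * Q) = -f Q) → (∀ x, ∑ Q, f Q * indG T₀.1 (x * Q) = 0) → ∀ Q, f Q = 0)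
    (S : Finset (CMF G c →₀ ℤ)) (hS : (↑S : Set (CMF G c →₀ ℤ)) ⊆ gfaceSet G c hc2)
    (hli : LinearIndepOn (ZMod 2) (fun f : CMF G c →₀ ℤ => (rad2 c hc2).mkQ (red c f)) ↑S)
    (hN : ∀ n ∈ N, ∀ f ∈ gfaceSet G c hc2, red c (Finsupp.mapDomain (rt c n) f - f) ∈
      pair2 c ⊔ Submodule.span (ZMod 2) (translates2 c (S.image (red c))))
    (k : ℕ) (hred : ∀ Φ : CMF G c, ((2 : ℤ) ^ k) • Finsupp.single Φ (1 : ℤ) ∈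
      (Submodule.span ℤ (pairSet c) ⊔ Submodule.span ℤ (translates c S)) ⊔
        Submodule.span ℤ (Set.range fun Q : G => Finsupp.single (rt c Q T₀) (1 : ℤ))) :
    ∃ S' : Finset (CMF G c →₀ ℤ), S ⊆ S' ∧ (↑S' : Set (CMF G c →₀ ℤ)) ⊆ gfaceSet G c hc2 ∧ S'.card = fibreTwo c hc2 ∧
      hodgeSpan c hc2 ≤ Submodule.span ℤ (pairSet c) ⊔ Submodule.span ℤ (translates c S') :=
  exists_generate_extension_of_isPGroup_rel c hΓ ι N hcov hc2 hc1 hcen S hS hli hN k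
    (two_pow_smul_mem_psp_of_reduction c hc2 hcen T₀ hT₀ S (hS.trans (gfaceSet_subset_hodgeSpan c hc2)) k hred)

/-- **RELATIVE META-THEOREM: `μ(G,c) = φ₂(G,c)`** for a factorised group `G = ι(Γ)·⟨N⟩` (`Γ` a `2`-group), from a fibre-independent complete
reduction onto a nondegenerate base type whose target contains the `N`-coboundaries of the faces mod `2`. [folklore] -/
theorem isLeast_card_gfaces_generate_of_reduction_rel (hΓ : IsPGroup 2 Γ) (ι : Γ →* G) (N : Set G)
    (hcov : ∀ Q : G, ∃ γ : Γ, ∃ n ∈ Subgroup.closure N, Q = ι γ * n)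
    (hc2 : c * c = 1) (hc1 : c ≠ 1) (hcen : ∀ x : G, x * c = c * x) (T₀ : CMF G c)
    (hT₀ : ∀ f : G → ℤ, (∀ Q, f (c * Q) = -f Q) → (∀ x, ∑ Q, f Q * indG T₀.1 (x * Q) = 0) → ∀ Q, f Q = 0)
    (S : Finset (CMF G c →₀ ℤ)) (hS : (↑S : Set (CMF G c →₀ ℤ)) ⊆ gfaceSet G c hc2)
    (hli : LinearIndepOn (ZMod 2) (fun f : CMF G c →₀ ℤ => (rad2 c hc2).mkQ (red c f)) ↑S)
    (hN : ∀ n ∈ N, ∀ f ∈ gfaceSet G c hc2, red c (Finsupp.mapDomain (rt c n) f - f) ∈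
      pair2 c ⊔ Submodule.span (ZMod 2) (translates2 c (S.image (red c))))
    (k : ℕ) (hred : ∀ Φ : CMF G c, ((2 : ℤ) ^ k) • Finsupp.single Φ (1 : ℤ) ∈
      (Submodule.span ℤ (pairSet c) ⊔ Submodule.span ℤ (translates c S)) ⊔
        Submodule.span ℤ (Set.range fun Q : G => Finsupp.single (rt c Q T₀) (1 : ℤ))) :
    IsLeast {n : ℕ | ∃ S' : Finset (CMF G c →₀ ℤ), (↑S' ⊆ gfaceSet G c hc2) ∧ S'.card = n ∧
      hodgeSpan c hc2 ≤ Submodule.span ℤ (pairSet c) ⊔ Submodule.span ℤ (translates c S')} (fibreTwo c hc2) :=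
  isLeast_card_gfaces_generate_of_isPGroup_rel c hΓ ι N hcov hc2 hc1 hcen S hS hli hN k
    (two_pow_smul_mem_psp_of_reduction c hc2 hcen T₀ hT₀ S (hS.trans (gfaceSet_subset_hodgeSpan c hc2)) k hred)

/-- **Parity form**: the same with block-parity independence of `S` (sufficient for fibre independence, any `G`). [folklore] -/
theorem isLeast_card_gfaces_generate_of_reduction_par_rel (hΓ : IsPGroup 2 Γ) (ι : Γ →* G) (N : Set G)
    (hcov : ∀ Q : G, ∃ γ : Γ, ∃ n ∈ Subgroup.closure N, Q = ι γ * n)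
    (hc2 : c * c = 1) (hc1 : c ≠ 1) (hcen : ∀ x : G, x * c = c * x) (T₀ : CMF G c)
    (hT₀ : ∀ f : G → ℤ, (∀ Q, f (c * Q) = -f Q) → (∀ x, ∑ Q, f Q * indG T₀.1 (x * Q) = 0) → ∀ Q, f Q = 0)
    (S : Finset (CMF G c →₀ ℤ)) (hS : (↑S : Set (CMF G c →₀ ℤ)) ⊆ gfaceSet G c hc2)
    (hpar : LinearIndepOn (ZMod 2) (fun f : CMF G c →₀ ℤ => par c f) ↑S)
    (hN : ∀ n ∈ N, ∀ f ∈ gfaceSet G c hc2, red c (Finsupp.mapDomain (rt c n) f - f) ∈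
      pair2 c ⊔ Submodule.span (ZMod 2) (translates2 c (S.image (red c))))
    (k : ℕ) (hred : ∀ Φ : CMF G c, ((2 : ℤ) ^ k) • Finsupp.single Φ (1 : ℤ) ∈
      (Submodule.span ℤ (pairSet c) ⊔ Submodule.span ℤ (translates c S)) ⊔
        Submodule.span ℤ (Set.range fun Q : G => Finsupp.single (rt c Q T₀) (1 : ℤ))) :
    IsLeast {n : ℕ | ∃ S' : Finset (CMF G c →₀ ℤ), (↑S' ⊆ gfaceSet G c hc2) ∧ S'.card = n ∧
      hodgeSpan c hc2 ≤ Submodule.span ℤ (pairSet c) ⊔ Submodule.span ℤ (translates c S')} (fibreTwo c hc2) :=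
  isLeast_card_gfaces_generate_of_reduction_rel c hΓ ι N hcov hc2 hc1 hcen T₀ hT₀ S hS
    (fibreIndep_of_parityIndep c hc2 _ hpar) hN k hred

/-- **RESIDUAL FORM** (with the covering of part C, any `(G,c)`).  Factorised `G = ι(Γ)·⟨N⟩`, nondegenerate `T₀`; a family `S ⊆ gfaceSet` which
CONTAINS a covering family of `T₀` (modulo `ℤ⟨base changes of S⟩` every type is a combination of RESIDUAL types, `bpot T₀ ≤ 1`), is
fibre-independent, reduces every RESIDUAL type onto the base changes of `T₀` up to `2^k`, and whose target contains the `N`-coboundaries of the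
faces mod `2` `⟹ μ(G,c) = φ₂(G,c)`. [folklore] -/
theorem isLeast_card_gfaces_generate_of_residual_reduction_rel (hΓ : IsPGroup 2 Γ) (ι : Γ →* G) (N : Set G)
    (hcov : ∀ Q : G, ∃ γ : Γ, ∃ n ∈ Subgroup.closure N, Q = ι γ * n)
    (hc2 : c * c = 1) (hc1 : c ≠ 1) (hcen : ∀ x : G, x * c = c * x) (T₀ : CMF G c)
    (hT₀ : ∀ f : G → ℤ, (∀ Q, f (c * Q) = -f Q) → (∀ x, ∑ Q, f Q * indG T₀.1 (x * Q) = 0) → ∀ Q, f Q = 0)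
    (S : Finset (CMF G c →₀ ℤ)) (hS : (↑S : Set (CMF G c →₀ ℤ)) ⊆ gfaceSet G c hc2)
    (hli : LinearIndepOn (ZMod 2) (fun f : CMF G c →₀ ℤ => (rad2 c hc2).mkQ (red c f)) ↑S)
    (hN : ∀ n ∈ N, ∀ f ∈ gfaceSet G c hc2, red c (Finsupp.mapDomain (rt c n) f - f) ∈
      pair2 c ⊔ Submodule.span (ZMod 2) (translates2 c (S.image (red c))))
    (hcv : ∀ Φ : CMF G c, Finsupp.single Φ (1 : ℤ) ∈
      (Submodule.span ℤ (pairSet c) ⊔ Submodule.span ℤ (translates c S)) ⊔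
        Submodule.span ℤ ((fun Ψ => Finsupp.single Ψ (1 : ℤ)) '' {Ψ : CMF G c | bpot c T₀ Ψ ≤ 1})) (k : ℕ)
    (hres : ∀ Ψ : CMF G c, bpot c T₀ Ψ ≤ 1 → ((2 : ℤ) ^ k) • Finsupp.single Ψ (1 : ℤ) ∈
      (Submodule.span ℤ (pairSet c) ⊔ Submodule.span ℤ (translates c S)) ⊔
        Submodule.span ℤ (Set.range fun Q : G => Finsupp.single (rt c Q T₀) (1 : ℤ))) :
    IsLeast {n : ℕ | ∃ S' : Finset (CMF G c →₀ ℤ), (↑S' ⊆ gfaceSet G c hc2) ∧ S'.card = n ∧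
      hodgeSpan c hc2 ≤ Submodule.span ℤ (pairSet c) ⊔ Submodule.span ℤ (translates c S')} (fibreTwo c hc2) :=
  isLeast_card_gfaces_generate_of_reduction_rel c hΓ ι N hcov hc2 hc1 hcen T₀ hT₀ S hS hli hN k
    (reduction_of_residual c T₀ _ {Ψ : CMF G c | bpot c T₀ Ψ ≤ 1} k hcv (fun Ψ hΨ => hres Ψ hΨ))

/-- **Subgroup form of the residual META theorem** (`P ≤ G` a `2`-subgroup, `G = P·⟨N⟩`). [folklore] -/
theorem isLeast_card_gfaces_generate_of_residual_reduction_subgroup (P : Subgroup G) (hP : IsPGroup 2 P) (N : Set G)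
    (hcov : ∀ Q : G, ∃ p ∈ P, ∃ n ∈ Subgroup.closure N, Q = p * n)
    (hc2 : c * c = 1) (hc1 : c ≠ 1) (hcen : ∀ x : G, x * c = c * x) (T₀ : CMF G c)
    (hT₀ : ∀ f : G → ℤ, (∀ Q, f (c * Q) = -f Q) → (∀ x, ∑ Q, f Q * indG T₀.1 (x * Q) = 0) → ∀ Q, f Q = 0)
    (S : Finset (CMF G c →₀ ℤ)) (hS : (↑S : Set (CMF G c →₀ ℤ)) ⊆ gfaceSet G c hc2)
    (hli : LinearIndepOn (ZMod 2) (fun f : CMF G c →₀ ℤ => (rad2 c hc2).mkQ (red c f)) ↑S)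
    (hN : ∀ n ∈ N, ∀ f ∈ gfaceSet G c hc2, red c (Finsupp.mapDomain (rt c n) f - f) ∈
      pair2 c ⊔ Submodule.span (ZMod 2) (translates2 c (S.image (red c))))
    (hcv : ∀ Φ : CMF G c, Finsupp.single Φ (1 : ℤ) ∈
      (Submodule.span ℤ (pairSet c) ⊔ Submodule.span ℤ (translates c S)) ⊔
        Submodule.span ℤ ((fun Ψ => Finsupp.single Ψ (1 : ℤ)) '' {Ψ : CMF G c | bpot c T₀ Ψ ≤ 1})) (k : ℕ)
    (hres : ∀ Ψ : CMF G c, bpot c T₀ Ψ ≤ 1 → ((2 : ℤ) ^ k) • Finsupp.single Ψ (1 : ℤ) ∈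
      (Submodule.span ℤ (pairSet c) ⊔ Submodule.span ℤ (translates c S)) ⊔
        Submodule.span ℤ (Set.range fun Q : G => Finsupp.single (rt c Q T₀) (1 : ℤ))) :
    IsLeast {n : ℕ | ∃ S' : Finset (CMF G c →₀ ℤ), (↑S' ⊆ gfaceSet G c hc2) ∧ S'.card = n ∧
      hodgeSpan c hc2 ≤ Submodule.span ℤ (pairSet c) ⊔ Submodule.span ℤ (translates c S')} (fibreTwo c hc2) :=
  isLeast_card_gfaces_generate_of_residual_reduction_rel c hP P.subtype N
    (fun Q => by
      obtain ⟨p, hp, n, hn, rfl⟩ := hcov Q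
      exact ⟨⟨p, hp⟩, n, hn, rfl⟩)
    hc2 hc1 hcen T₀ hT₀ S hS hli hN hcv k hres

end

end Summit.HodgeConjecture.CorCM.Census.Splitting
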